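import Mathlib.LinearAlgebra.Matrix.Charpoly.Coeff
import Mathlib.Data.Matrix.Basis
import Literature.LinearAlgebra.Matrix.Berkowitz
import Literature.Computability.AlgebraicComplexity.IMMInVPProofs
import Literature.Computability.AlgebraicComplexity.ArithCircuitProofs
import Literature.Computability.AlgebraicComplexity.ValiantConjecture
import HarnessLib

/-!
# `DET ∈ VP` — discharge of `isVPFamily_detPoly` and `isPFamily_detPoly` (Berkowitz 1984)

Discharge (D-0014) of the named facts
`Literature.Computability.AlgebraicComplexity.isVPFamily_detPoly` (`ValiantConjecture.lean`,
Valiant 1979 / Bürgisser 2000, Prop. 2.30: the determinant family is in `VP` over every field)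
and `Literature.Computability.AlgebraicComplexity.isPFamily_detPoly` (`StandardFamilies.lean`),
for the tree's fan-in-two `complexity` and generic determinant `detPoly (Fin n) k = det (X_{ij})`.

## The printed algorithm and the circuit formalised

Berkowitz 1984 (exposition: Soltys 2002, §2, Def. 2): the coefficient vector of the
characteristic polynomial of an `n × n` matrix `A` is an ITERATED MATRIX PRODUCT
`χ_A = C_1 C_2 ⋯ C_n` of lower-triangular Toeplitz matrices whose entries are `1`, `-a_{tt}` and
the numbers `-R_t M_t^q S_t` built from the principal submatrices `M_t`, their bordering rows
`R_t` and columns `S_t`; no divisions occur, so the algorithm is valid over every commutative ring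
and yields polynomial-size arithmetic circuits for `χ_A`, hence for `det A = (-1)^n χ_A(0)`.

Here (bordering by the LAST row/column, principal submatrices = upper-left blocks
`genBlock t = (X_{ij})_{i,j<t}`; the algebra — Samuelson's identity and the adjugate of the
characteristic matrix — is `Literature.LinearAlgebra.Matrix.charpoly_coeff_eq_berkowitz`):

* `toep t` is the `t`-th Toeplitz factor, padded with zeros to a fixed size `(n+1) × (n+1)`
  (`toepEntry`), and `toep t *ᵥ (coefficients of χ_{genBlock t}) = coefficients of
  χ_{genBlock (t+1)}` (`toep_mulVec_cvec`); hence the coefficient vector of `χ_{genBlock n}` is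
  `toep (n-1) ⋯ toep 0 · e₀` (`toepProd_mulVec`), and
  `det (X_{ij}) = (-1)^n [X^0] χ = tr(E · toep (n-1) ⋯ toep 0)` with `E = (-1)^n e₀ e₀ᵀ`.
* SHARING WITHOUT MULTI-OUTPUT CIRCUITS: the tree's `complexity` is single-output, so the product
  is not evaluated vector by vector (that would re-compute every coefficient `n` times per level);
  instead the whole product is ONE instance of the iterated-matrix-multiplication polynomial:
  `det (X_{ij}) = IMM_{n+1,n+1}(E, toep (n-1), …, toep 0)` (`aeval_detSubst_immPoly`), and
  likewise each Toeplitz entry `R M^q S = tr((S Rᵀ)ᵀ… ) = IMM_{t,q+1}(S ⊗ R, M, …, M)`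
  (`berkNum_eq_aeval`). With `IMM ∈ VP` PROVED in the tree (`complexity_immPoly_le`:
  `L(IMM_{N,d}) ≤ N + 2N³d`, Kumar–Saraf 2017 §3) and the substitution bound
  `L(f(g)) ≤ L(f) + ∑ L(g_v)` (`complexity_aeval_le`, Bürgisser 2000 Rem. 2.7) this gives
  `L(R M^q S) ≤ 5(n+1)⁴`, `L(DET_n) ≤ 8 (n+1)⁷` (`complexity_detPoly_le`) — the polynomial size of
  the source (Berkowitz: size `O(n^{3.5})`-ish and depth `O(log² n)`; only polynomial size is
  claimed here).

Over every commutative ring `k`: `isVPFamily_detPoly_of_commRing`; the facts as stated (fields):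
`isVPFamily_detPoly_holds`, `detFamily_mem_VP_holds`, and `isPFamily_detPoly_holds`.

## References

* [Berkowitz1984] S. J. Berkowitz, *On computing the determinant in small parallel time using a
  small number of processors*, Inform. Process. Lett. 18 (1984) 147–150.
* [Soltys2002] M. Soltys, *Berkowitz's algorithm and clow sequences*, Electron. J. Linear
  Algebra 9 (2002) 42–54, §2, Def. 2 (Berkowitz's algorithm `p_A = C_1 C_2 ⋯ C_n`).
* [Burgisser2000] P. Bürgisser, *Completeness and Reduction in Algebraic Complexity Theory*,
  Springer 2000, Def. 2.1–2.4, Rem. 2.7, Prop. 2.30 (`DET ∈ VP`).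
* [KumarSaraf2017] M. Kumar, S. Saraf, SIAM J. Comput. 46 (2017), §3 (`IMM ∈ VP`).
-/

noncomputable section

open MvPolynomial

namespace Literature.Computability.AlgebraicComplexity

universe u

/-! ### Substituting into the iterated matrix multiplication polynomial -/

section AevalIMM

variable {k : Type u} [CommSemiring k] {σ : Type*}

/-- Substituting polynomials `g (u, i, j)` for the variables `X⁽ᵘ⁾_{ij}` of
`IMM_{N,d} = tr(X⁽⁰⁾ ⋯ X⁽ᵈ⁻¹⁾)` gives the trace of the product of the substituted matrices
(`aeval` is a ring homomorphism; Bürgisser 2000, Rem. 2.7). [cite: Burgisser2000, Rem. 2.7] -/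
theorem aeval_immPoly (N d : ℕ) (g : Fin d × Fin N × Fin N → MvPolynomial σ k) :
    aeval g (immPoly N d k) =
      (((List.finRange d).map fun u => Matrix.of fun i j => g (u, i, j)).prod).trace := by
  set F : MvPolynomial (Fin d × Fin N × Fin N) k →+* MvPolynomial σ k := (aeval g).toRingHom
    with hFdef
  have hF : ∀ p, F p = aeval g p := fun p => rfl
  have hlayer : ∀ u : Fin d, F.mapMatrix ((Matrix.mvPolynomialX (Fin N) (Fin N) k).map
      (rename fun ij : Fin N × Fin N => (u, ij))) = Matrix.of fun i j => g (u, i, j) := by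
    intro u
    refine Matrix.ext fun i j => ?_
    simp [RingHom.mapMatrix_apply, Matrix.mvPolynomialX, hF]
  have hprod : F.mapMatrix (immMatrix (Fin N) d k) =
      ((List.finRange d).map fun u => Matrix.of fun i j => g (u, i, j)).prod := by
    unfold immMatrix
    rw [map_list_prod, List.map_map]
    exact congrArg List.prod (List.map_congr_left fun u _ => hlayer u)
  unfold immPoly
  rw [← hF, ← hprod, RingHom.mapMatrix_apply]
  exact AddMonoidHom.map_trace F _

end AevalIMM

/-! ### Negation costs one gate -/

section NegCost

variable {k : Type u} [CommRing k] {σ : Type*}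

/-- Negation costs one gate (`-f = (-1) • f`; Bürgisser 2000, §2.1). [cite: Burgisser2000, §2.1] -/
theorem complexity_neg_le (f : MvPolynomial σ k) : complexity (-f) ≤ complexity f + 1 := by
  rw [← neg_one_smul k f]
  exact complexity_smul_le_holds _ _

end NegCost

/-! ### Berkowitz's Toeplitz factors for the generic matrix -/

namespace Berkowitz

variable (k : Type u) [CommRing k] (n : ℕ)

/-- The entry `X_{ab}` of the generic `n × n` matrix for arbitrary natural indices, `0` out of
range (so that all blocks below are defined for every `t`). [folklore] -/
def xvar (a b : ℕ) : MvPolynomial (Fin n × Fin n) k :=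
  if h : a < n ∧ b < n then X (⟨a, h.1⟩, ⟨b, h.2⟩) else 0

/-- The upper-left `t × t` block `M_t = (X_{ij})_{i,j<t}` of the generic matrix — the principal
submatrices of Berkowitz's algorithm (Soltys 2002, §2, Def. 2, there lower-right blocks).
[cite: Soltys2002, §2 Def. 2] -/
def genBlock (t : ℕ) : Matrix (Fin t) (Fin t) (MvPolynomial (Fin n × Fin n) k) :=
  Matrix.of fun i j => xvar k n i j

/-- The characteristic polynomial of the `t`-th block. [cite: Soltys2002, §2 Def. 2] -/
def chi (t : ℕ) : Polynomial (MvPolynomial (Fin n × Fin n) k) :=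
  (genBlock k n t).charpoly

/-- Its coefficient vector, padded to the fixed length `n + 1`. [cite: Soltys2002, §2 Def. 2] -/
def cvec (t : ℕ) : Fin (n + 1) → MvPolynomial (Fin n × Fin n) k :=
  fun p => (chi k n t).coeff p

/-- Berkowitz's numbers `R_t M_t^q S_t` (row `R_t = (X_{t j})_{j<t}`, column
`S_t = (X_{i t})_{i<t}`). [cite: Soltys2002, §2 Def. 2] -/
def berkNum (t q : ℕ) : MvPolynomial (Fin n × Fin n) k :=
  ∑ j : Fin t, ∑ i : Fin t, xvar k n t j * (genBlock k n t ^ q) j i * xvar k n i t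

/-- The entries of Berkowitz's `t`-th lower-triangular Toeplitz factor `(1, -X_{tt}, -R_t S_t,
-R_t M_t S_t, …)`, indexed by increasing degree (`l` = output degree, `p` = input degree) and
extended by `0`. [cite: Soltys2002, §2 Def. 2] -/
def toepEntry (t l p : ℕ) : MvPolynomial (Fin n × Fin n) k :=
  if p + 1 = l then 1
  else if p = l then -xvar k n t t
  else if l < p ∧ p ≤ t then -berkNum k n t (p - (l + 1))
  else 0

/-- The `t`-th Toeplitz factor as a square matrix of the fixed size `n + 1`.
[cite: Soltys2002, §2 Def. 2] -/
def toep (t : ℕ) : Matrix (Fin (n + 1)) (Fin (n + 1)) (MvPolynomial (Fin n × Fin n) k) :=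
  Matrix.of fun l p => toepEntry k n t l p

/-- The partial products `toep (t-1) ⋯ toep 0` of Berkowitz's algorithm (Soltys 2002, §2,
Def. 2: `p_A = C_1 C_2 ⋯ C_n`). [cite: Soltys2002, §2 Def. 2] -/
def toepProd (t : ℕ) : Matrix (Fin (n + 1)) (Fin (n + 1)) (MvPolynomial (Fin n × Fin n) k) :=
  ((List.finRange t).map fun u : Fin t => toep k n (t - (u + 1))).prod

variable {k n}

/-- Entries of the blocks. [folklore] -/
@[simp] theorem genBlock_apply (t : ℕ) (i j : Fin t) : genBlock k n t i j = xvar k n i j := rfl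

/-- The full block is the generic matrix. [folklore] -/
theorem genBlock_self : genBlock k n n = Matrix.mvPolynomialX (Fin n) (Fin n) k := by
  refine Matrix.ext fun i j => ?_
  simp [genBlock, xvar, Matrix.mvPolynomialX]

/-- Consecutive blocks are nested. [folklore] -/
theorem genBlock_succ_submatrix (t : ℕ) :
    (genBlock k n (t + 1)).submatrix Fin.castSucc Fin.castSucc = genBlock k n t := by
  refine Matrix.ext fun i j => ?_
  simp

/-- `χ` of the empty block is `1`. [folklore] -/
theorem chi_zero : chi k n 0 = 1 := by
  simp [chi, Matrix.charpoly]

/-- Hence its coefficient vector is `e₀`. [folklore] -/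
theorem cvec_zero : cvec k n 0 = Pi.single 0 1 := by
  funext p
  simp only [cvec, chi_zero, Polynomial.coeff_one, Pi.single_apply, Fin.ext_iff, Fin.val_zero]

/-- **Berkowitz's recursion for the generic blocks** (from
`Literature.LinearAlgebra.Matrix.charpoly_coeff_eq_berkowitz`). [cite: Soltys2002, §2 Def. 2] -/
theorem chi_succ_coeff (t l : ℕ) :
    (chi k n (t + 1)).coeff l =
      (if l = 0 then 0 else (chi k n t).coeff (l - 1)) - xvar k n t t * (chi k n t).coeff l -
        ∑ p ∈ Finset.Ioc l t, (chi k n t).coeff p * berkNum k n t (p - (l + 1)) := by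
  unfold chi berkNum
  rw [Literature.LinearAlgebra.Matrix.charpoly_coeff_eq_berkowitz, genBlock_succ_submatrix]
  simp only [genBlock_apply, Fin.val_last, Fin.val_castSucc]

/-- One column of the Toeplitz factor against an arbitrary coefficient sequence `c`:
`∑_p toepEntry t l p · c_p = c_{l-1} − X_{tt} c_l − ∑_{l<p≤t} c_p · R M^{p-l-1} S`.
[cite: Soltys2002, §2 Def. 2] -/
theorem sum_toepEntry_mul (t l : ℕ) (hl : l ≤ n) (ht : t ≤ n)
    (c : ℕ → MvPolynomial (Fin n × Fin n) k) :
    ∑ p ∈ Finset.range (n + 1), toepEntry k n t l p * c p =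
      (if l = 0 then 0 else c (l - 1)) - xvar k n t t * c l -
        ∑ p ∈ Finset.Ioc l t, c p * berkNum k n t (p - (l + 1)) := by
  have hsplit : ∀ p, toepEntry k n t l p * c p =
      (if p + 1 = l then c p else 0) + ((if p = l then -(xvar k n t t * c p) else 0) +
        (if l < p ∧ p ≤ t then -(c p * berkNum k n t (p - (l + 1))) else 0)) := by
    intro p
    unfold toepEntry
    split_ifs <;> first | ring1 | (exfalso; omega)
  have hS1 : ∑ p ∈ Finset.range (n + 1), (if p + 1 = l then c p else 0) =
      if l = 0 then 0 else c (l - 1) := by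
    by_cases hl0 : l = 0
    · simp [hl0]
    · rw [if_neg hl0]
      have h : ∀ p, (p + 1 = l ↔ p = l - 1) := fun p => by omega
      simp_rw [h]
      rw [Finset.sum_ite_eq', if_pos (Finset.mem_range.2 (by omega))]
  have hS2 : ∑ p ∈ Finset.range (n + 1), (if p = l then -(xvar k n t t * c p) else 0) =
      -(xvar k n t t * c l) := by
    rw [Finset.sum_ite_eq', if_pos (Finset.mem_range.2 (by omega))]
  have hS3 : ∑ p ∈ Finset.range (n + 1),
      (if l < p ∧ p ≤ t then -(c p * berkNum k n t (p - (l + 1))) else 0) =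
        -∑ p ∈ Finset.Ioc l t, c p * berkNum k n t (p - (l + 1)) := by
    have hset : (Finset.range (n + 1)).filter (fun p => l < p ∧ p ≤ t) = Finset.Ioc l t := by
      ext p
      simp only [Finset.mem_filter, Finset.mem_range, Finset.mem_Ioc]
      omega
    rw [← Finset.sum_filter, ← Finset.sum_neg_distrib, hset]
  simp_rw [hsplit, Finset.sum_add_distrib]
  rw [hS1, hS2, hS3]
  ring

/-- **The Toeplitz step**: `toep t · (coefficients of χ_{M_t}) = coefficients of χ_{M_{t+1}}`
(Soltys 2002, §2, `p = C_1 q`). [cite: Soltys2002, §2 Def. 2] -/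
theorem toep_mulVec_cvec (t : ℕ) (ht : t < n) :
    Matrix.mulVec (toep k n t) (cvec k n t) = cvec k n (t + 1) := by
  funext l
  simp only [Matrix.mulVec, dotProduct, toep, Matrix.of_apply, cvec]
  rw [chi_succ_coeff]
  exact (Fin.sum_univ_eq_sum_range (fun p => toepEntry k n t l p * (chi k n t).coeff p)
    (n + 1)).trans (sum_toepEntry_mul t l (Nat.lt_succ_iff.1 l.isLt) ht.le _)

/-- Unfolding the partial products. [cite: Soltys2002, §2 Def. 2] -/
theorem toepProd_succ (t : ℕ) : toepProd k n (t + 1) = toep k n t * toepProd k n t := by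
  have h : (List.finRange (t + 1)).map (fun u : Fin (t + 1) => toep k n (t + 1 - (u + 1))) =
      toep k n t :: (List.finRange t).map (fun u : Fin t => toep k n (t - (u + 1))) := by
    rw [List.finRange_succ, List.map_cons, List.map_map]
    refine congrArg₂ List.cons (by simp) (List.map_congr_left fun u _ => ?_)
    simp only [Function.comp_apply, Fin.val_succ]
    rw [Nat.add_sub_add_right]
  unfold toepProd
  rw [h, List.prod_cons]

/-- **Berkowitz's theorem for the generic matrix**: `toep (t-1) ⋯ toep 0 · e₀` is the coefficient
vector of `χ_{M_t}` (Soltys 2002, §2, Def. 2, `p_A = C_1 ⋯ C_n`). [cite: Soltys2002, §2 Def. 2] -/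
theorem toepProd_mulVec (t : ℕ) (ht : t ≤ n) :
    Matrix.mulVec (toepProd k n t) (cvec k n 0) = cvec k n t := by
  induction t with
  | zero => simp [toepProd]
  | succ t ih =>
    rw [toepProd_succ, ← Matrix.mulVec_mulVec, ih (Nat.le_of_succ_le ht),
      toep_mulVec_cvec t (Nat.lt_of_succ_le ht)]

/-- The determinant of the generic matrix from the product: `det (X_{ij}) = (-1)^n (toep ⋯ toep)₀₀`.
[cite: Soltys2002, §2 Def. 2] -/
theorem detPoly_eq_toepProd :
    detPoly (Fin n) k = (-1) ^ n * toepProd k n n 0 0 := by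
  have h1 : toepProd k n n 0 0 = (chi k n n).coeff 0 := by
    have h := congrFun (toepProd_mulVec (k := k) (n := n) n le_rfl) 0
    rw [cvec_zero, Matrix.mulVec_single_one] at h
    simpa [cvec] using h
  rw [h1, chi, genBlock_self, detPoly, Matrix.det_eq_sign_charpoly_coeff, Fintype.card_fin]

/-! ### The substitutions into `IMM` -/

variable (k n)

/-- The substitution realising `R_t M_t^q S_t` as `IMM_{t,q+1}(S_t ⊗ R_t, M_t, …, M_t)`.
[cite: Soltys2002, §2 Def. 2] -/
def berkSubst (t q : ℕ) : Fin (q + 1) × Fin t × Fin t → MvPolynomial (Fin n × Fin n) k :=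
  fun v => if (v.1 : ℕ) = 0 then xvar k n v.2.1 t * xvar k n t v.2.2 else xvar k n v.2.1 v.2.2

/-- The substitution realising `det (X_{ij})` as `IMM_{n+1,n+1}((-1)^n e₀e₀ᵀ, toep (n-1), …,
toep 0)`. [cite: Soltys2002, §2 Def. 2] -/
def detSubst : Fin (n + 1) × Fin (n + 1) × Fin (n + 1) → MvPolynomial (Fin n × Fin n) k :=
  fun v => if (v.1 : ℕ) = 0 then
      Matrix.single (0 : Fin (n + 1)) (0 : Fin (n + 1)) (C ((-1 : k) ^ n)) v.2.1 v.2.2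
    else toep k n (n - v.1) v.2.1 v.2.2

variable {k n}

/-- `R_t M_t^q S_t = IMM_{t,q+1}(S_t ⊗ R_t, M_t, …, M_t)`. [cite: Soltys2002, §2 Def. 2] -/
theorem berkNum_eq_aeval (t q : ℕ) :
    berkNum k n t q = aeval (berkSubst k n t q) (immPoly t (q + 1) k) := by
  rw [aeval_immPoly, List.finRange_succ, List.map_cons, List.map_map, List.prod_cons]
  have htail : ((List.finRange q).map ((fun u : Fin (q + 1) => Matrix.of fun i j =>
      berkSubst k n t q (u, i, j)) ∘ Fin.succ)) = (List.finRange q).map fun _ => genBlock k n t := by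
    refine List.map_congr_left fun u _ => Matrix.ext fun i j => ?_
    simp [berkSubst, Fin.succ_ne_zero]
  have hhead : (Matrix.of fun i j => berkSubst k n t q (0, i, j)) =
      Matrix.of fun i j : Fin t => xvar k n i t * xvar k n t j := by
    refine Matrix.ext fun i j => ?_
    simp [berkSubst]
  rw [htail, hhead, List.map_const', List.prod_replicate, List.length_finRange]
  unfold berkNum Matrix.trace
  simp only [Matrix.diag, Matrix.mul_apply, Matrix.of_apply]
  rw [Finset.sum_comm]
  refine Finset.sum_congr rfl fun j _ => Finset.sum_congr rfl fun i _ => ?_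
  ring

/-- `det (X_{ij}) = IMM_{n+1,n+1}((-1)^n e₀e₀ᵀ, toep (n-1), …, toep 0)`.
[cite: Soltys2002, §2 Def. 2] -/
theorem aeval_detSubst_immPoly :
    aeval (detSubst k n) (immPoly (n + 1) (n + 1) k) = detPoly (Fin n) k := by
  rw [aeval_immPoly, List.finRange_succ, List.map_cons, List.map_map, List.prod_cons]
  have htail : ((List.finRange n).map ((fun u : Fin (n + 1) => Matrix.of fun i j =>
      detSubst k n (u, i, j)) ∘ Fin.succ)) =
        (List.finRange n).map fun u : Fin n => toep k n (n - (u + 1)) := by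
    refine List.map_congr_left fun u _ => Matrix.ext fun i j => ?_
    simp [detSubst, Fin.succ_ne_zero]
  have hhead : (Matrix.of fun i j => detSubst k n (0, i, j)) =
      Matrix.single (0 : Fin (n + 1)) (0 : Fin (n + 1)) (C ((-1 : k) ^ n)) := by
    refine Matrix.ext fun i j => ?_
    simp [detSubst]
  rw [htail, hhead, Matrix.trace_single_mul, smul_eq_mul, detPoly_eq_toepProd]
  simp [toepProd, map_pow, map_neg, map_one]

/-! ### Cost of the substitutions -/

/-- The entries `X_{ab}` (or `0`) are free. [cite: Burgisser2000, Def. 2.1] -/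
theorem complexity_xvar (a b : ℕ) : complexity (xvar k n a b) = 0 := by
  unfold xvar
  split_ifs
  · exact complexity_X_holds _
  · simpa using complexity_C_holds (σ := Fin n × Fin n) (0 : k)

/-- **`L(R_t M_t^q S_t) ≤ t + 2t³(q+1) + t²`** by `IMM ∈ VP` and the substitution bound.
[cite: KumarSaraf2017, §3] [cite: Burgisser2000, Rem. 2.7] -/
theorem complexity_berkNum_le (t q : ℕ) :
    complexity (berkNum k n t q) ≤ t + 2 * t ^ 3 * (q + 1) + t ^ 2 := by
  rw [berkNum_eq_aeval]
  have h0 : ∀ i j : Fin t, complexity (berkSubst k n t q (0, i, j)) ≤ 1 := by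
    intro i j
    simp only [berkSubst, Fin.val_zero, ↓reduceIte]
    calc complexity (xvar k n i t * xvar k n t j)
        ≤ complexity (xvar k n i t) + complexity (xvar k n t j) + 1 := complexity_mul_le_holds _ _
      _ = 1 := by rw [complexity_xvar, complexity_xvar]
  have hs : ∀ (u : Fin q) (i j : Fin t), complexity (berkSubst k n t q (u.succ, i, j)) = 0 := by
    intro u i j
    simp only [berkSubst, Fin.val_succ, Nat.add_one_ne_zero, ↓reduceIte]
    exact complexity_xvar _ _
  have hsum : ∑ v, complexity (berkSubst k n t q v) ≤ t ^ 2 := by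
    calc ∑ v, complexity (berkSubst k n t q v)
        = ∑ u : Fin (q + 1), ∑ i : Fin t, ∑ j : Fin t, complexity (berkSubst k n t q (u, i, j)) := by
          rw [Fintype.sum_prod_type]
          exact Finset.sum_congr rfl fun u _ => Fintype.sum_prod_type _
      _ = ∑ i : Fin t, ∑ j : Fin t, complexity (berkSubst k n t q (0, i, j)) := by
          rw [Fin.sum_univ_succ]
          simp [hs]
      _ ≤ ∑ _i : Fin t, ∑ _j : Fin t, 1 := Finset.sum_le_sum fun i _ => Finset.sum_le_sum fun j _ => h0 i j
      _ = t ^ 2 := by simp; ring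
  calc complexity (aeval (berkSubst k n t q) (immPoly t (q + 1) k))
      ≤ complexity (immPoly t (q + 1) k) + ∑ v, complexity (berkSubst k n t q v) :=
        complexity_aeval_le _ _
    _ ≤ (t + 2 * t ^ 3 * (q + 1)) + t ^ 2 := Nat.add_le_add (complexity_immPoly_le k t (q + 1)) hsum

/-- Polynomial bookkeeping. [folklore] -/
theorem berk_cost_le {t q n : ℕ} (ht : t ≤ n) (hq : q ≤ n) :
    t + 2 * t ^ 3 * (q + 1) + t ^ 2 + 1 ≤ 5 * (n + 1) ^ 4 := by
  have h0 : n + 1 ≤ (n + 1) ^ 4 := by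
    calc n + 1 = (n + 1) ^ 1 := (pow_one _).symm
      _ ≤ (n + 1) ^ 4 := Nat.pow_le_pow_right (Nat.succ_pos n) (by norm_num)
  have h1 : t ≤ (n + 1) ^ 4 := by omega
  have h2 : 2 * t ^ 3 * (q + 1) ≤ 2 * (n + 1) ^ 4 := by
    calc 2 * t ^ 3 * (q + 1) ≤ 2 * (n + 1) ^ 3 * (n + 1) :=
          Nat.mul_le_mul (Nat.mul_le_mul_left 2 (Nat.pow_le_pow_left (by omega) 3)) (by omega)
      _ = 2 * (n + 1) ^ 4 := by ring
  have h3 : t ^ 2 ≤ (n + 1) ^ 4 := by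
    calc t ^ 2 ≤ (n + 1) ^ 2 := Nat.pow_le_pow_left (by omega) 2
      _ ≤ (n + 1) ^ 4 := Nat.pow_le_pow_right (by omega) (by omega)
  have h4 : 1 ≤ (n + 1) ^ 4 := Nat.one_le_pow _ _ (by omega)
  omega

/-- Every entry of every (padded) Toeplitz factor costs at most `5 (n+1)⁴` gates.
[cite: Soltys2002, §2 Def. 2] [cite: Burgisser2000, Rem. 2.7] -/
theorem complexity_toepEntry_le (t l p : ℕ) (ht : t ≤ n) :
    complexity (toepEntry k n t l p) ≤ 5 * (n + 1) ^ 4 := by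
  have h4 : 1 ≤ (n + 1) ^ 4 := Nat.one_le_pow _ _ (by omega)
  unfold toepEntry
  split_ifs with h1 h2 h3
  · rw [show (1 : MvPolynomial (Fin n × Fin n) k) = C 1 from C_1.symm, complexity_C_holds]
    exact Nat.zero_le _
  · calc complexity (-xvar k n t t) ≤ complexity (xvar k n t t) + 1 := complexity_neg_le _
      _ = 1 := by rw [complexity_xvar]
      _ ≤ 5 * (n + 1) ^ 4 := by omega
  · calc complexity (-berkNum k n t (p - (l + 1)))
        ≤ complexity (berkNum k n t (p - (l + 1))) + 1 := complexity_neg_le _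
      _ ≤ t + 2 * t ^ 3 * (p - (l + 1) + 1) + t ^ 2 + 1 :=
          Nat.add_le_add_right (complexity_berkNum_le t _) 1
      _ ≤ 5 * (n + 1) ^ 4 := berk_cost_le ht (by omega)
  · rw [show (0 : MvPolynomial (Fin n × Fin n) k) = C 0 from C_0.symm, complexity_C_holds]
    exact Nat.zero_le _

/-- Every substituted entry costs at most `5 (n+1)⁴` gates. [cite: Burgisser2000, Rem. 2.7] -/
theorem complexity_detSubst_le (v : Fin (n + 1) × Fin (n + 1) × Fin (n + 1)) :
    complexity (detSubst k n v) ≤ 5 * (n + 1) ^ 4 := by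
  unfold detSubst
  split_ifs with h
  · by_cases h0 : (0 : Fin (n + 1)) = v.2.1 ∧ (0 : Fin (n + 1)) = v.2.2
    · rw [Matrix.single, Matrix.of_apply, if_pos h0, complexity_C_holds]
      exact Nat.zero_le _
    · rw [Matrix.single, Matrix.of_apply, if_neg h0,
        show (0 : MvPolynomial (Fin n × Fin n) k) = C 0 from C_0.symm, complexity_C_holds]
      exact Nat.zero_le _
  · exact complexity_toepEntry_le _ _ _ (Nat.sub_le _ _)

end Berkowitz

/-! ### The size bound and the discharges -/

section Discharge

/-- **`L(DET_n) ≤ 8 (n+1)⁷`**: Berkowitz's algorithm as one iterated matrix product.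
[cite: Berkowitz1984, §2] [cite: Soltys2002, §2 Def. 2] [cite: KumarSaraf2017, §3] -/
theorem complexity_detPoly_le (k : Type u) [CommRing k] (n : ℕ) :
    complexity (detPoly (Fin n) k) ≤ 8 * (n + 1) ^ 7 := by
  rw [← Berkowitz.aeval_detSubst_immPoly]
  have hsum : ∑ v, complexity (Berkowitz.detSubst k n v) ≤ (n + 1) ^ 3 * (5 * (n + 1) ^ 4) := by
    calc ∑ v, complexity (Berkowitz.detSubst k n v)
        ≤ (Finset.univ : Finset (Fin (n + 1) × Fin (n + 1) × Fin (n + 1))).card •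
            (5 * (n + 1) ^ 4) :=
          Finset.sum_le_card_nsmul _ _ _ fun v _ => Berkowitz.complexity_detSubst_le v
      _ = (n + 1) ^ 3 * (5 * (n + 1) ^ 4) := by
          simp only [Finset.card_univ, Fintype.card_prod, Fintype.card_fin, smul_eq_mul]; ring
  calc complexity (aeval (Berkowitz.detSubst k n) (immPoly (n + 1) (n + 1) k))
      ≤ complexity (immPoly (n + 1) (n + 1) k) + ∑ v, complexity (Berkowitz.detSubst k n v) :=
        complexity_aeval_le _ _
    _ ≤ ((n + 1) + 2 * (n + 1) ^ 3 * (n + 1)) + (n + 1) ^ 3 * (5 * (n + 1) ^ 4) :=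
        Nat.add_le_add (complexity_immPoly_le k (n + 1) (n + 1)) hsum
    _ ≤ 8 * (n + 1) ^ 7 := by
        have h1 : n + 1 ≤ (n + 1) ^ 7 := by
          calc n + 1 = (n + 1) ^ 1 := (pow_one _).symm
            _ ≤ (n + 1) ^ 7 := Nat.pow_le_pow_right (by omega) (by omega)
        have h2 : 2 * (n + 1) ^ 3 * (n + 1) ≤ 2 * (n + 1) ^ 7 := by
          calc 2 * (n + 1) ^ 3 * (n + 1) = 2 * (n + 1) ^ 4 := by ring
            _ ≤ 2 * (n + 1) ^ 7 :=
                Nat.mul_le_mul_left 2 (Nat.pow_le_pow_right (by omega) (by omega))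
        have h3 : (n + 1) ^ 3 * (5 * (n + 1) ^ 4) = 5 * (n + 1) ^ 7 := by ring
        omega

/-- Discharge of `isPFamily_detPoly` (`StandardFamilies.lean`): `n²` variables, degree `≤ n`
(Bürgisser 2000, §2.1). [cite: Burgisser2000, §2.1] -/
theorem isPFamily_detPoly_holds {k : Type u} : isPFamily_detPoly (k := k) := by
  intro _
  refine ⟨(IsPBounded.iff_exists_le_mul_succ_pow _).2 ⟨1, 2, fun m => ?_⟩,
    (IsPBounded.iff_exists_le_mul_succ_pow _).2 ⟨1, 1, fun m => ?_⟩⟩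
  · have h : 1 * (m + 1) ^ 2 = m * m + 2 * m + 1 := by ring
    simp only [Fintype.card_prod, Fintype.card_fin]
    omega
  · dsimp only
    calc (detPoly (Fin m) k).totalDegree ≤ Fintype.card (Fin m) :=
          detPoly_isHomogeneous.totalDegree_le
      _ ≤ 1 * (m + 1) ^ 1 := by simp

/-- **`DET ∈ VP` over every commutative ring** (Berkowitz 1984; Bürgisser 2000, Prop. 2.30):
p-family by `isPFamily_detPoly_holds`, `L(DET_n) ≤ 8(n+1)⁷` by `complexity_detPoly_le`.
[cite: Berkowitz1984, §2] [cite: Burgisser2000, Prop. 2.30] -/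
theorem isVPFamily_detPoly_of_commRing (k : Type u) [CommRing k] :
    IsVPFamily fun n => detPoly (Fin n) k :=
  ⟨isPFamily_detPoly_holds,
    (IsPBounded.iff_exists_le_mul_succ_pow _).2 ⟨8, 7, fun n => complexity_detPoly_le k n⟩⟩

variable (k : Type u) [Field k]

/-- **Discharge of `isVPFamily_detPoly`** (`ValiantConjecture.lean`; Valiant 1979; Bürgisser
2000, Prop. 2.30): the determinant family is in `VP` over every field.
[cite: Burgisser2000, Prop. 2.30] [cite: Berkowitz1984, §2] -/
theorem isVPFamily_detPoly_holds : isVPFamily_detPoly k :=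
  isVPFamily_detPoly_of_commRing k

/-- **Discharge of `detFamily_mem_VP`** (`ValiantConjecture.lean`; Bürgisser 2000, Prop. 2.30):
the bundled determinant family lies in `VP k`. [cite: Burgisser2000, Prop. 2.30] -/
theorem detFamily_mem_VP_holds : detFamily_mem_VP k :=
  (mem_VP_ofFintype_iff_holds _).2 (isVPFamily_detPoly_holds k)

end Discharge

end Literature.Computability.AlgebraicComplexity
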